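/-
Copyright: the b2b-balaban cell (near-miss cell 7), T⁴-continuum fan-out; row NE7b ROUND-2 swarm, seat
t4-ne7b-formalise-leaf-10 (gen 5; row W2 of `t4/b2b-balaban-t4-ne7b-p1/LEAVES-NE7b.md` v3.14, owner's ruling
R-OWNER-23-2: road W-RP-VAR, LIVE SECONDARY).  A port of the NE7 ideation seat's scratch `t4/b2b-balaban-t4-ne7-p2/g27/
Sketch.lean` §2–§4 (memo `IDEAS-NE7-g27.md` §1 (CB)(ARITH)), with the zero case and the log-depth summability added.
Released under the licence of the surrounding project.
-/
import Mathlib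
import Literature.Probability.LatticeModels.ChessboardEstimateAssignments

/-!
# Road W-RP-VAR, step (CB)(ARITH): CHESSBOARD ⇒ PER-CELL DENSITY ⇒ UNION BOUND ⇒ SUMMABLE BUDGET

Summits-side support leaf of the T⁴-continuum cell (rung (B)+1 on a FINITE torus only; NOT infinite volume, NOT the
mass gap, NOT the Clay statement; NOT a proof of the spine estimate NE7b).  Row NE7b, road **W-RP-VAR** (owner's
ruling R-OWNER-23-2: a LIVE SECONDARY road beside the COUNT road of record), row **W2** of the claim table.
[folklore] finite arithmetic over the tree's abstract chessboard estimate
`Literature.Probability.LatticeModels.chessboard_pow_le_even` (Fröhlich–Israel–Lieb–Simon 1978, Thm. 4.1, kernel-proved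
in the tree for every EVEN torus side) and its assignment form `ChessboardEstimateAssignments` (the zero case), BOTH
CONSUMED BY NAME; nothing is quoted from Bałaban's papers, nothing printed is asserted, no `[cite:]` tag of the series,
no `Prop`-valued fact minted (trigger c1).  Mathlib + those two Literature files only.

WHY (memo §1, road W-RP-VAR).  Reflection positivity of the run's extended measure (the displayed binder (RP-ext)+(VAR)
of row W4 — for the CENTRED-averaging variant; for Bałaban's printed corner prescription RP of the extended measure FAILS
as located in R-OWNER-23-2 (iii)) gives, for the set function `ψ S := ⟨∏_{c ∈ S} 1_{E_c}⟩` of cell events on the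
`N^d`-cell torus, the reflection Cauchy–Schwarz inequalities; the chessboard estimate turns them into
`ψ S ^ (N^d) ≤ ψ univ ^ #S`; ONE bound on the universally forced pattern `ψ univ ≤ r ^ (N^d)` (row W4's displayed
(U1)+(G2)) then yields the PER-CELL DENSITY `ψ S ≤ r ^ #S`, the union bound `Σ_c ψ {c} ≤ N^d · r`, and — summed over
the `2^d` shifted tilings and the depths `m ≥ m_K` with a geometric per-depth rate — a budget `W K = c · ρ ^ (m_K)`,
summable over `K` as soon as the depth grows like `⌈C·log (K+1)⌉` with `C·log ρ⁻¹ > 1`.  This file is exactly that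
arithmetic; the measure, the events, (RP-ext), (U1), (G2) and the assembly to `RelWeightBound` are rows W1∕W3∕W4.

WHAT.
* §1 `density_le_of_chessboard` — from the CONCLUSION of the chessboard estimate + `ψ univ ≤ r ^ (N^d)`:
  `ψ S ≤ r ^ #S` (the exponent `N^d` is load-bearing, §5).
* §2 `indicator_cs` and the zero case **`univ_pos_of_pos`** (reflection Cauchy–Schwarz alone: `0 < ψ S` for some
  `S ∋ t₀` forces `0 < ψ univ` — the set-function form of the tree's `chessboard_eq_zero_of_const_eq_zero`, through the
  indicator assignment, `filter_asgSymP_eq_symP`∕`filter_asgSymM_eq_symM` and `good_const_of_asgSym_stable`),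
  **`density_le_of_rp`** (from the HYPOTHESES of `chessboard_pow_le_even`) and **`density_le_of_rp'`** (the same
  WITHOUT `0 < ψ univ`).  No definition is introduced (0 def).
* §3 union bounds: `sum_singleton_density_le`, **`sum_singleton_density_le_of_rp`** (+ primed form), and the sum over
  a finite family of tilings ∕ patterns `sum_sum_singleton_le`.
* §4 budget: `tsum_geometric_tail`, `tsum_shift_le_of_geometric` (a per-depth rate `r m ≤ c·ρ^m` sums to
  `≤ c·ρ^{m₀}∕(1 − ρ)` beyond depth `m₀`), `summable_budget`, **`pow_ceil_log_le_rpow`** ∕ **`summable_pow_ceil_log`**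
  (`K ↦ ρ ^ ⌈C·log (K+1)⌉₊` is dominated by `(K+1)^{−C·log ρ⁻¹}`, summable when `1 < C·log ρ⁻¹`) and the composed
  **`summable_budget_log`**.
* §5 planted-false control (memo §4, kept as an `example`): `x² ≤ r ⇏ x ≤ r`.

HONEST SCOPE.  Arithmetic shell of ONE producer of NE7b's socket for the CENTRED-AVERAGING VARIANT of the construction
(R-OWNER-23-2 (iii)); even with W1–W4 complete, NE7b would be discharged only modulo the displayed binders (VAR), (U1),
(G2), (EXT)∕(RP-ext).  Nothing of H3 ∕ (B) ∕ BetaPertH is touched; NE7b NOT proved; spine 0∕9.  HONEST DEPENDENCY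
(cell): continuum YM on T⁴ ⇐ BetaPertH ∧ nine spine estimates (0/9 proved); BetaPertH ⇐ (D1) ∧ (D4) ∧ CAP+tail; G-an2-4
gates asym, D1 and NE2/3/4.  This file changes none of it.
-/

noncomputable section

namespace Summit.QuantumFields.BalabanUV.T4Continuum.HistoryChessboardDensity

open Finset Real
open Literature.Barriers.CriticalPhenomena.NonGibbs Literature.Probability.LatticeModels

/-! ## §1 From the conclusion of the chessboard estimate: per-cell density -/

section Conclusion

variable {d N : ℕ} [NeZero N]

/-- **CHESSBOARD CONCLUSION + UNIVERSAL BOUND ⇒ DENSITY.**  From `ψ S ^ (N^d) ≤ ψ univ ^ #S` (the conclusion of the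
chessboard estimate) and ONE bound on the universally forced pattern `ψ univ ≤ r ^ (N^d)`: `ψ S ≤ r ^ #S` for every set
of cells `S` (take `N^d`-th roots of `ψ S ^ (N^d) ≤ (r ^ (N^d)) ^ #S = (r ^ #S) ^ (N^d)`). [folklore] -/
theorem density_le_of_chessboard {ψ : Finset (BlockIdx d N) → ℝ} {r : ℝ}
    (h0 : ∀ S, 0 ≤ ψ S) (hr : 0 ≤ r)
    (hcb : ∀ S, ψ S ^ (N ^ d) ≤ ψ univ ^ #S) (huniv : ψ univ ≤ r ^ (N ^ d))
    (S : Finset (BlockIdx d N)) : ψ S ≤ r ^ #S := by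
  have hNd : N ^ d ≠ 0 := pow_ne_zero _ (NeZero.ne N)
  have h1 : ψ S ^ (N ^ d) ≤ (r ^ #S) ^ (N ^ d) :=
    calc ψ S ^ (N ^ d) ≤ ψ univ ^ #S := hcb S
      _ ≤ (r ^ (N ^ d)) ^ #S := pow_le_pow_left₀ (h0 _) huniv _
      _ = (r ^ #S) ^ (N ^ d) := by rw [← pow_mul, ← pow_mul, mul_comm]
  exact le_of_pow_le_pow_left₀ hNd (pow_nonneg hr _) h1

end Conclusion

/-! ## §2 From reflection Cauchy–Schwarz (the hypotheses of the tree's chessboard estimate) -/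

section RP

variable {d N : ℕ} [NeZero N]

/-- **THE SET FUNCTION READ ON INDICATOR ASSIGNMENTS obeys reflection Cauchy–Schwarz**: for
`Ψ τ := ψ {c | τ c = true}` on `τ : BlockIdx d N → Bool`, the set function's inequalities at `{c | τ c = true}` are
`Ψ τ ^ 2 ≤ Ψ (asgSymP i k τ) · Ψ (asgSymM i k τ)` (even `N`: the tree's `filter_asgSymP_eq_symP` ∕
`filter_asgSymM_eq_symM`). [folklore] -/
theorem indicator_cs (hN : Even N) {ψ : Finset (BlockIdx d N) → ℝ}
    (hcs : ∀ (i : Fin d) (k : ZMod N) (S : Finset (BlockIdx d N)),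
      ψ S ^ 2 ≤ ψ (symP i k S) * ψ (symM i k S))
    (i : Fin d) (k : ZMod N) (τ : BlockIdx d N → Bool) :
    ψ (univ.filter fun c => τ c = true) ^ 2 ≤
      ψ (univ.filter fun c => asgSymP i k τ c = true) * ψ (univ.filter fun c => asgSymM i k τ c = true) := by
  rw [filter_asgSymP_eq_symP hN i k τ true, filter_asgSymM_eq_symM hN i k τ true]
  exact hcs i k _

/-- **THE ZERO CASE** (set-function form of the tree's `chessboard_eq_zero_of_const_eq_zero`): under reflection
Cauchy–Schwarz for every block reflection of an even torus, `0 ≤ ψ` and `0 < ψ S` for some `S` containing a cell force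
`0 < ψ univ` — non-vanishing of `ψ` read on indicator assignments is stable under both symmetrisations, and the
tree's doubling argument `good_const_of_asgSym_stable` carries it from the indicator of `S` to the constant assignment
at a cell of `S`, i.e. to `univ`. [folklore] -/
theorem univ_pos_of_pos (hN : Even N) {ψ : Finset (BlockIdx d N) → ℝ} (h0 : ∀ S, 0 ≤ ψ S)
    (hcs : ∀ (i : Fin d) (k : ZMod N) (S : Finset (BlockIdx d N)),
      ψ S ^ 2 ≤ ψ (symP i k S) * ψ (symM i k S))
    {S : Finset (BlockIdx d N)} {t₀ : BlockIdx d N} (ht₀ : t₀ ∈ S) (hS : 0 < ψ S) : 0 < ψ univ := by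
  classical
  -- non-vanishing of `ψ` on indicator assignments is stable under both symmetrisations
  have key : ∀ τ : BlockIdx d N → Bool, ψ (univ.filter fun c => τ c = true) ≠ 0 → ∀ (i : Fin d) (k : ZMod N),
      ψ (univ.filter fun c => asgSymP i k τ c = true) ≠ 0 ∧ ψ (univ.filter fun c => asgSymM i k τ c = true) ≠ 0 := by
    intro τ hτ i k
    have h := indicator_cs hN hcs i k τ
    have h2 : 0 < ψ (univ.filter fun c => τ c = true) ^ 2 := by positivity
    constructor <;> intro h' <;> simp only [h', zero_mul, mul_zero] at h <;> linarith
  -- the indicator of `S` reads `ψ S ≠ 0`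
  have hSf : (univ.filter fun c => decide (c ∈ S) = true) = S := by
    ext c; simp
  have hS' : ψ (univ.filter fun c => decide (c ∈ S) = true) ≠ 0 := by
    rw [hSf]; exact hS.ne'
  have hgood := good_const_of_asgSym_stable hN (Good := fun τ => ψ (univ.filter fun c => τ c = true) ≠ 0)
    (fun i k τ hτ => (key τ hτ i k).1) (fun i k τ hτ => (key τ hτ i k).2) hS' t₀
  -- the constant assignment at `t₀ ∈ S` is the constant `true`, whose set is `univ`
  have huf : (univ.filter fun _ : BlockIdx d N => decide (t₀ ∈ S) = true) = univ := by
    ext c; simp [ht₀]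
  have huniv : ψ univ ≠ 0 := by
    have h := hgood
    simp only at h
    rwa [huf] at h
  exact lt_of_le_of_ne (h0 _) (Ne.symm huniv)

/-- **RP ⇒ DENSITY** (from the HYPOTHESES of the tree's chessboard estimate `chessboard_pow_le_even` — reflection
Cauchy–Schwarz for every block reflection of a torus of EVEN side, `ψ ≥ 0`, `ψ ∅ ≤ 1`, `0 < ψ univ` — and the universal
bound `ψ univ ≤ r ^ (N^d)`): `ψ S ≤ r ^ #S`. [folklore] -/
theorem density_le_of_rp (hN : Even N) {ψ : Finset (BlockIdx d N) → ℝ} {r : ℝ}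
    (h0 : ∀ S, 0 ≤ ψ S) (hempty : ψ ∅ ≤ 1) (h1 : 0 < ψ univ)
    (hcs : ∀ (i : Fin d) (k : ZMod N) (S : Finset (BlockIdx d N)),
      ψ S ^ 2 ≤ ψ (symP i k S) * ψ (symM i k S))
    (hr : 0 ≤ r) (huniv : ψ univ ≤ r ^ (N ^ d)) (S : Finset (BlockIdx d N)) :
    ψ S ≤ r ^ #S :=
  density_le_of_chessboard h0 hr (chessboard_pow_le_even hN h0 hempty h1 hcs) huniv S

/-- **RP ⇒ DENSITY, WITHOUT THE POSITIVITY HYPOTHESIS**: if `ψ univ = 0` the zero case makes `ψ` vanish on every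
non-empty `S`, and `ψ ∅ ≤ 1 = r ^ 0`. [folklore] -/
theorem density_le_of_rp' (hN : Even N) {ψ : Finset (BlockIdx d N) → ℝ} {r : ℝ}
    (h0 : ∀ S, 0 ≤ ψ S) (hempty : ψ ∅ ≤ 1)
    (hcs : ∀ (i : Fin d) (k : ZMod N) (S : Finset (BlockIdx d N)),
      ψ S ^ 2 ≤ ψ (symP i k S) * ψ (symM i k S))
    (hr : 0 ≤ r) (huniv : ψ univ ≤ r ^ (N ^ d)) (S : Finset (BlockIdx d N)) :
    ψ S ≤ r ^ #S := by
  by_cases h1 : 0 < ψ univ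
  · exact density_le_of_rp hN h0 hempty h1 hcs hr huniv S
  · rcases S.eq_empty_or_nonempty with rfl | ⟨t₀, ht₀⟩
    · simpa using hempty
    · have hS : ψ S = 0 := by
        by_contra hne
        exact h1 (univ_pos_of_pos hN h0 hcs ht₀ (lt_of_le_of_ne (h0 S) (Ne.symm hne)))
      rw [hS]
      exact pow_nonneg hr _

end RP

/-! ## §3 Union bounds -/

section Union

variable {d N : ℕ} [NeZero N]

/-- **UNION BOUND OVER CELLS**: a per-cell bound `ψ {c} ≤ r` sums to `Σ_c ψ {c} ≤ N^d · r` (the number of cells of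
the torus `(ℤ∕N)^d` is `N^d`). [folklore] -/
theorem sum_singleton_density_le {ψ : Finset (BlockIdx d N) → ℝ} {r : ℝ}
    (hcell : ∀ c : BlockIdx d N, ψ {c} ≤ r) :
    ∑ c : BlockIdx d N, ψ {c} ≤ (N : ℝ) ^ d * r := by
  calc ∑ c : BlockIdx d N, ψ {c} ≤ ∑ _c : BlockIdx d N, r := sum_le_sum fun c _ => hcell c
    _ = (N : ℝ) ^ d * r := by
        rw [sum_const, nsmul_eq_mul, Finset.card_univ]
        simp [BlockIdx, ZMod.card]

/-- **RP ⇒ TOTAL SINGLE-CELL DENSITY `≤ N^d · r`** (the two steps composed, hypotheses of `chessboard_pow_le_even`).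
[folklore] -/
theorem sum_singleton_density_le_of_rp (hN : Even N) {ψ : Finset (BlockIdx d N) → ℝ} {r : ℝ}
    (h0 : ∀ S, 0 ≤ ψ S) (hempty : ψ ∅ ≤ 1) (h1 : 0 < ψ univ)
    (hcs : ∀ (i : Fin d) (k : ZMod N) (S : Finset (BlockIdx d N)),
      ψ S ^ 2 ≤ ψ (symP i k S) * ψ (symM i k S))
    (hr : 0 ≤ r) (huniv : ψ univ ≤ r ^ (N ^ d)) :
    ∑ c : BlockIdx d N, ψ {c} ≤ (N : ℝ) ^ d * r :=
  sum_singleton_density_le fun c => by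
    simpa using density_le_of_rp hN h0 hempty h1 hcs hr huniv {c}

/-- … and WITHOUT the positivity hypothesis. [folklore] -/
theorem sum_singleton_density_le_of_rp' (hN : Even N) {ψ : Finset (BlockIdx d N) → ℝ} {r : ℝ}
    (h0 : ∀ S, 0 ≤ ψ S) (hempty : ψ ∅ ≤ 1)
    (hcs : ∀ (i : Fin d) (k : ZMod N) (S : Finset (BlockIdx d N)),
      ψ S ^ 2 ≤ ψ (symP i k S) * ψ (symM i k S))
    (hr : 0 ≤ r) (huniv : ψ univ ≤ r ^ (N ^ d)) :
    ∑ c : BlockIdx d N, ψ {c} ≤ (N : ℝ) ^ d * r :=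
  sum_singleton_density_le fun c => by
    simpa using density_le_of_rp' hN h0 hempty hcs hr huniv {c}

/-- **OVER A FINITE FAMILY OF PATTERNS** (the `2^d` shifted tilings, the depths of a finite range, …): if pattern `λ`
has total single-cell density `≤ N^d · r λ`, the family has total `≤ N^d · Σ_λ r λ`. [folklore] -/
theorem sum_sum_singleton_le {Λ : Type*} (F : Finset Λ) {ψ : Λ → Finset (BlockIdx d N) → ℝ} {r : Λ → ℝ}
    (h : ∀ l ∈ F, ∑ c : BlockIdx d N, ψ l {c} ≤ (N : ℝ) ^ d * r l) :
    ∑ l ∈ F, ∑ c : BlockIdx d N, ψ l {c} ≤ (N : ℝ) ^ d * ∑ l ∈ F, r l := by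
  rw [mul_sum]
  exact sum_le_sum h

end Union

/-! ## §4 The budget: geometric tails over the depth, summability over the cutoff -/

section Budget

/-- **GEOMETRIC TAIL** over the depth (or birth age): `Σ_n ρ^{A+n} = ρ^A ∕ (1 − ρ)` for `0 ≤ ρ < 1`. [folklore] -/
theorem tsum_geometric_tail {ρ : ℝ} (h0 : 0 ≤ ρ) (h1 : ρ < 1) (A : ℕ) :
    ∑' n : ℕ, ρ ^ (A + n) = ρ ^ A / (1 - ρ) := by
  simp_rw [pow_add]
  rw [tsum_mul_left, tsum_geometric_of_lt_one h0 h1, div_eq_mul_inv]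

/-- the shifted geometric family is summable [folklore] -/
theorem summable_geometric_tail {ρ : ℝ} (h0 : 0 ≤ ρ) (h1 : ρ < 1) (A : ℕ) :
    Summable fun n : ℕ => ρ ^ (A + n) := by
  simp_rw [pow_add]
  exact (summable_geometric_of_lt_one h0 h1).mul_left _

/-- **A PER-DEPTH RATE BELOW A GEOMETRIC ONE SUMS GEOMETRICALLY BEYOND ANY DEPTH**: `0 ≤ r m ≤ c · ρ^m` for all `m`
gives `Σ_n r (m₀ + n) ≤ c · ρ^{m₀} ∕ (1 − ρ)`. [folklore] -/
theorem tsum_shift_le_of_geometric {r : ℕ → ℝ} {c ρ : ℝ} (h0 : 0 ≤ ρ) (h1 : ρ < 1)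
    (hr0 : ∀ m, 0 ≤ r m) (hr : ∀ m, r m ≤ c * ρ ^ m) (m₀ : ℕ) :
    ∑' n : ℕ, r (m₀ + n) ≤ c * ρ ^ m₀ / (1 - ρ) := by
  have hmaj : Summable fun n : ℕ => c * ρ ^ (m₀ + n) := (summable_geometric_tail h0 h1 m₀).mul_left c
  have hsum : Summable fun n : ℕ => r (m₀ + n) :=
    Summable.of_nonneg_of_le (fun n => hr0 _) (fun n => hr (m₀ + n)) hmaj
  calc ∑' n : ℕ, r (m₀ + n) ≤ ∑' n : ℕ, c * ρ ^ (m₀ + n) := hsum.tsum_le_tsum (fun n => hr _) hmaj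
    _ = c * ρ ^ m₀ / (1 - ρ) := by rw [tsum_mul_left, tsum_geometric_tail h0 h1, mul_div_assoc]

/-- **BUDGET SUMMABILITY** from the window term: if `K ↦ ρ ^ (aK K)` is summable then so is `W K = c · ρ ^ (aK K)`
(`c` collects the number of cells `N^d`, the `2^d` tilings, the per-cell stability slack and `(1 − ρ)⁻¹`). [folklore] -/
theorem summable_budget {ρ c : ℝ} {aK : ℕ → ℕ} (h : Summable fun K => ρ ^ aK K) :
    Summable fun K => c * ρ ^ aK K :=
  h.mul_left c

/-- **LOG DEPTH AGAINST A GEOMETRIC RATE IS A POWER OF THE CUTOFF**: for `0 < ρ ≤ 1`, `0 ≤ C`,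
`ρ ^ ⌈C·log (K+1)⌉₊ ≤ (K+1)^{−(C·log ρ⁻¹)} = 1 ∕ |K+1| ^ (C·log ρ⁻¹)`. [folklore] -/
theorem pow_ceil_log_le_rpow {ρ C : ℝ} (h0 : 0 < ρ) (h1 : ρ ≤ 1) (hC : 0 ≤ C) (K : ℕ) :
    ρ ^ ⌈C * Real.log ((K : ℝ) + 1)⌉₊ ≤ 1 / |(K : ℝ) + 1| ^ (C * Real.log ρ⁻¹) := by
  have hK : (0 : ℝ) < (K : ℝ) + 1 := by positivity
  have hlogK : 0 ≤ Real.log ((K : ℝ) + 1) := Real.log_nonneg (by linarith)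
  have hx : 0 ≤ C * Real.log ((K : ℝ) + 1) := mul_nonneg hC hlogK
  -- `ρ ^ ⌈x⌉₊ ≤ ρ ^ x` as real powers (`ρ ≤ 1`, `x ≤ ⌈x⌉₊`)
  have hstep : ρ ^ ⌈C * Real.log ((K : ℝ) + 1)⌉₊ ≤ ρ ^ (C * Real.log ((K : ℝ) + 1)) := by
    rw [← Real.rpow_natCast]
    exact Real.rpow_le_rpow_of_exponent_ge h0 h1 (Nat.le_ceil _)
  refine hstep.trans (le_of_eq ?_)
  -- `ρ ^ (C·log (K+1)) = (K+1) ^ (C·log ρ) = 1 ∕ (K+1) ^ (C·log ρ⁻¹)`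
  rw [abs_of_pos hK, Real.log_inv, mul_neg, Real.rpow_neg hK.le, one_div, inv_inv,
    Real.rpow_def_of_pos h0, Real.rpow_def_of_pos hK]
  congr 1
  ring

/-- **SUMMABILITY OF THE LOG-DEPTH WINDOW TERM**: for `0 < ρ < 1` and `1 < C·log ρ⁻¹` the family
`K ↦ ρ ^ ⌈C·log (K+1)⌉₊` is summable (comparison with the `p`-series, `p = C·log ρ⁻¹ > 1`). [folklore] -/
theorem summable_pow_ceil_log {ρ C : ℝ} (h0 : 0 < ρ) (h1 : ρ < 1) (hC : 0 ≤ C) (hp : 1 < C * Real.log ρ⁻¹) :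
    Summable fun K : ℕ => ρ ^ ⌈C * Real.log ((K : ℝ) + 1)⌉₊ := by
  refine Summable.of_nonneg_of_le (fun K => pow_nonneg h0.le _) (fun K => pow_ceil_log_le_rpow h0 h1.le hC K) ?_
  exact (Real.summable_one_div_nat_add_rpow 1 (C * Real.log ρ⁻¹)).2 hp

/-- **THE COMPOSED BUDGET IS SUMMABLE**: `W K = c · ρ ^ ⌈C·log (K+1)⌉₊` with `0 < ρ < 1`, `0 ≤ C`, `1 < C·log ρ⁻¹`.
[folklore] -/
theorem summable_budget_log {ρ C c : ℝ} (h0 : 0 < ρ) (h1 : ρ < 1) (hC : 0 ≤ C) (hp : 1 < C * Real.log ρ⁻¹) :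
    Summable fun K : ℕ => c * ρ ^ ⌈C * Real.log ((K : ℝ) + 1)⌉₊ :=
  summable_budget (aK := fun K => ⌈C * Real.log ((K : ℝ) + 1)⌉₊) (summable_pow_ceil_log h0 h1 hC hp)

end Budget

/-! ## §5 Planted-false control (memo §4): the exponent `N^d` on the universal bound is load-bearing -/

/-- CONTROL: without the exponent `N^d` on the universal bound the density conclusion FAILS — `x² ≤ r` does not give
`x ≤ r` (`x = 9∕10`, `r = 81∕100`). -/
example : ¬ ∀ x r : ℝ, 0 ≤ x → 0 ≤ r → x ^ 2 ≤ r → x ≤ r := by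
  intro h
  have := h (9/10) (81/100) (by norm_num) (by norm_num) (by norm_num)
  norm_num at this

/-- CONTROL (sanity of §1 at `N^d = 2`, `#S = 1`): WITH the exponent, `x² ≤ u`, `u ≤ r²` do give `x ≤ r`. -/
example (x u r : ℝ) (hx : 0 ≤ x) (hr : 0 ≤ r) (h1 : x ^ 2 ≤ u) (h2 : u ≤ r ^ 2) : x ≤ r :=
  (pow_le_pow_iff_left₀ hx hr two_ne_zero).1 (h1.trans h2)

end Summit.QuantumFields.BalabanUV.T4Continuum.HistoryChessboardDensity

end
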